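/-
PORT-SPLIT (pub-hodgecm2, COR-CM cell; slot b30 gen 2, bounce-buddy/backstop of the CupC chain, BINDER-OWNERS §8): the three
definitions of the stage-1 package file `HodgeCMPerL/HodgeCM/Proofs/CupC.lean` (pub-hodgecm HOME/lean, bytes of record md5
9563d47b1e33; port kit R3 #18 `Proofs/CupC.lean`) — `Universe.castCoh`, `Universe.castC`, `Universe.cupC` — hoisted VERBATIM
(docstrings, binders, bodies, fully-qualified names) into this definition-only file, so that their review (D-0009) runs early and
in parallel with kit #8 `Geometry/WeightVectors.lean` instead of after it (HOME/lean/LANDING-DAG.md: the DEF chain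
#8 → #18 → #22 → #23 → #24 feeds `Proofs/Pohlmann/WeightHodge.lean` #33); the port of the rest of that file (kit #18, theorems
only) imports this module. No other edit.
-/
import Summits.HodgeConjecture.CorCM.Geometry.Statements

/-!
# The complexified cup product in all degrees — definitions: degree transport and `cupC`

Definitions of `Summit.HodgeConjecture.CorCM.Universe.castCoh` / `castC` (transport of rational / complexified classes along a
degree equality `k = l`, the identity when `k = l` definitionally) and `Summit.HodgeConjecture.CorCM.Universe.cupC` (the
complexified cup product `H^i(X, ℂ) ⊗ H^j(X, ℂ) → H^{i+j}(X, ℂ)`, the base change of the universe's rational cup product `U.cup`;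
`cup2C` of `Geometry/Universe.lean` is the case `i = j`).  Their calculus (`castC_rfl`, `castC_tmul`, `cupC_tmul`, `pullC_cupC`,
…) is `Proofs/CupC.lean`.  Nothing is asserted here.
-/

noncomputable section

open scoped TensorProduct

namespace Summit.HodgeConjecture.CorCM

namespace Universe

variable (U : Universe)

/-! ### Degree transport and the general complexified cup product -/

/-- transport of rational classes along a degree equality -/
def castCoh (X : U.Var) {k l : ℕ} (h : k = l) : U.Coh X k ≃ₗ[ℚ] U.Coh X l := by
  subst h; exact LinearEquiv.refl ℚ _

/-- transport of complexified classes along a degree equality -/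
def castC (X : U.Var) {k l : ℕ} (h : k = l) : U.CohC X k ≃ₗ[ℂ] U.CohC X l := by
  subst h; exact LinearEquiv.refl ℂ _

/-- the complexified cup product `H^i(X, ℂ) ⊗ H^j(X, ℂ) → H^{i+j}(X, ℂ)` in all degrees (`cup2C` is the
case `i = j`) -/
def cupC (X : U.Var) (i j : ℕ) : U.CohC X i →ₗ[ℂ] U.CohC X j →ₗ[ℂ] U.CohC X (i + j) :=
  TensorProduct.curry (((TensorProduct.lift (U.cup X i j)).baseChange ℂ) ∘ₗ
    (TensorProduct.AlgebraTensorModule.distribBaseChange ℚ ℂ (U.Coh X i) (U.Coh X j)).symm.toLinearMap)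

end Universe

end Summit.HodgeConjecture.CorCM

end
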